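import Literature.Topology.FourManifolds.GaussDiagramsInsertReading
import HarnessLib

/-!
# Inserting new parameters into a reading: positions, order and the period window

Companion of `GaussDiagramsInsertReading.lean` (combinatorial layer of the event analysis for the
named fact `Knot.reidemeisterR`, direction `→`). `IsReadingMod.insertChord` lists a new chord of a
reading once merged parameters `θ₁` — the old parameters at the doubly renumbered positions of
`GaussDiagram.insertChord o u`, the two new ones at `o` and `o.succAbove u` — are given, strictly
increasing. This file PRODUCES such positions and parameters from the values alone:

* `exists_insert_position` — a value not taken by a strictly increasing tuple has an insertion
  position keeping the tuple strictly increasing (the number of smaller entries);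
* `exists_strictMono_insertNth` — hence `Fin.insertNth` at that position is strictly increasing;
* `GaussDiagram.exists_insertParams₂` — for two new chords (four new pairwise distinct values,
  none of them an old parameter) there are positions `o u o' u'` and strictly increasing merged
  tuples `θ₁` (one chord inserted) and `θ₂` (both inserted) with the value equations required by
  `IsReadingMod.insertChord` twice, every entry of `θ₂` being an old parameter or one of the four
  new values (whence the period condition and the adjacency conditions of
  `GaussDiagram.rEquiv_insertChord_insertChord` reduce to facts about the values).

Elementary bookkeeping; no analysis and no named facts.

## References

* M. Goussarov, M. Polyak, O. Viro, *Finite-type invariants of classical and virtual knots*,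
  Topology 39 (2000), §1.2. [GPV2000]
-/

open Function Set

noncomputable section

namespace Literature.Topology.FourManifolds

/-! ### Insertion positions -/

/-- **Insertion position.** A value `p` not taken by a strictly increasing tuple
`θ : Fin m → ℝ` has a position `k : Fin (m + 1)` with all entries before `k` below `p` and all
entries from `k` on above `p` (namely the number of entries below `p`). [folklore] -/
theorem exists_insert_position {m : ℕ} {θ : Fin m → ℝ} (hθ : StrictMono θ) {p : ℝ}
    (hp : ∀ q, θ q ≠ p) :
    ∃ k : Fin (m + 1), (∀ j : Fin m, j.castSucc < k → θ j < p) ∧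
      (∀ j : Fin m, k ≤ j.castSucc → p < θ j) := by
  classical
  set S : Finset (Fin m) := Finset.univ.filter (fun q ↦ θ q < p) with hS
  have hmemS : ∀ q, q ∈ S ↔ θ q < p := fun q ↦ by simp [hS]
  -- `S` is an initial segment of `Fin m`
  have hdown : ∀ {q q' : Fin m}, q' ≤ q → q ∈ S → q' ∈ S := fun h hq ↦
    (hmemS _).2 (((hθ.monotone h)).trans_lt ((hmemS _).1 hq))
  have hcard : ∀ q : Fin m, q ∈ S ↔ (q : ℕ) < S.card := by
    intro q
    constructor
    · intro hq
      have hsub : Finset.Iic q ⊆ S := fun q' hq' ↦ hdown (Finset.mem_Iic.1 hq') hq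
      have := Finset.card_le_card hsub
      rw [Fin.card_Iic] at this
      omega
    · intro hq
      by_contra hqS
      have hsub : S ⊆ Finset.Iio q := by
        intro q' hq'
        rw [Finset.mem_Iio]
        by_contra hle
        exact hqS (hdown (not_lt.1 hle) hq')
      have := Finset.card_le_card hsub
      rw [Fin.card_Iio] at this
      omega
  have hSm : S.card ≤ m := (Finset.card_le_univ S).trans_eq (Fintype.card_fin m)
  refine ⟨⟨S.card, Nat.lt_succ_of_le hSm⟩, fun j hj ↦ ?_, fun j hj ↦ ?_⟩
  · exact (hmemS j).1 ((hcard j).2 (by simpa [Fin.lt_def] using hj))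
  · have h1 : ¬ (j : ℕ) < S.card := by simpa [Fin.le_def] using hj
    have h2 : ¬ θ j < p := fun h ↦ h1 ((hcard j).1 ((hmemS j).2 h))
    exact lt_of_le_of_ne (not_lt.1 h2) (Ne.symm (hp j))

/-- **Inserting a new value keeps a strictly increasing tuple strictly increasing**, at the
insertion position. [folklore] -/
theorem exists_strictMono_insertNth {m : ℕ} {θ : Fin m → ℝ} (hθ : StrictMono θ) {p : ℝ}
    (hp : ∀ q, θ q ≠ p) :
    ∃ k : Fin (m + 1), StrictMono (k.insertNth (α := fun _ ↦ ℝ) p θ) := by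
  obtain ⟨k, h1, h2⟩ := exists_insert_position hθ hp
  exact ⟨k, strictMono_insertNth hθ h1 h2⟩

/-- The entries of an inserted tuple are the inserted value or old entries. [folklore] -/
theorem insertNth_eq_or_exists {m : ℕ} (k : Fin (m + 1)) (p : ℝ) (θ : Fin m → ℝ)
    (i : Fin (m + 1)) :
    k.insertNth (α := fun _ ↦ ℝ) p θ i = p ∨ ∃ q, k.insertNth (α := fun _ ↦ ℝ) p θ i = θ q := by
  rcases Fin.eq_self_or_eq_succAbove k i with h | ⟨j, h⟩
  · left
    rw [h, Fin.insertNth_apply_same]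
  · right
    exact ⟨j, by rw [h, Fin.insertNth_apply_succAbove]⟩

/-! ### Two new chords: positions and merged parameters -/

namespace GaussDiagram

variable (G : GaussDiagram)

/-- **Positions and merged parameters for two new chords.** Let `θ : Fin (2n) → ℝ` be strictly
increasing (the parameters of a reading of `G`) and let `p₁ₒ, p₁ᵤ, p₂ₒ, p₂ᵤ` be four pairwise
distinct values, none of them an entry of `θ` (over- and under-parameters of two new chords).
Then there are positions `o, u` (first chord) and `o', u'` (second chord) and strictly increasing
tuples `θ₁ : Fin (2n + 2) → ℝ`, `θ₂ : Fin (2n + 4) → ℝ` with the value equations of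
`IsReadingMod.insertChord` for `G.insertChord o u ·` w.r.t. `(θ, θ₁)` and for
`(G.insertChord o u ·).insertChord o' u' ·` w.r.t. `(θ₁, θ₂)`; every entry of `θ₂` is an old
parameter or one of the four new values. [folklore] -/
theorem exists_insertParams₂ {θ : Fin (2 * G.n) → ℝ} (hθ : StrictMono θ)
    {p₁ₒ p₁ᵤ p₂ₒ p₂ᵤ : ℝ} (h₁ : ∀ q, θ q ≠ p₁ₒ) (h₂ : ∀ q, θ q ≠ p₁ᵤ) (h₃ : ∀ q, θ q ≠ p₂ₒ)
    (h₄ : ∀ q, θ q ≠ p₂ᵤ) (h₁₂ : p₁ₒ ≠ p₁ᵤ) (h₁₃ : p₁ₒ ≠ p₂ₒ) (h₁₄ : p₁ₒ ≠ p₂ᵤ) (h₂₃ : p₁ᵤ ≠ p₂ₒ)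
    (h₂₄ : p₁ᵤ ≠ p₂ᵤ) (h₃₄ : p₂ₒ ≠ p₂ᵤ) :
    ∃ (o : Fin (2 * G.n + 2)) (u : Fin (2 * G.n + 1)) (o' : Fin (2 * (G.n + 1) + 2))
      (u' : Fin (2 * (G.n + 1) + 1)) (θ₁ : Fin (2 * G.n + 2) → ℝ)
      (θ₂ : Fin (2 * (G.n + 1) + 2) → ℝ),
      StrictMono θ₁ ∧ StrictMono θ₂ ∧
      θ₁ o = p₁ₒ ∧ θ₁ (o.succAbove u) = p₁ᵤ ∧ (∀ q, θ₁ (o.succAbove (u.succAbove q)) = θ q) ∧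
      θ₂ o' = p₂ₒ ∧ θ₂ (o'.succAbove u') = p₂ᵤ ∧ (∀ r, θ₂ (o'.succAbove (u'.succAbove r)) = θ₁ r) ∧
      ∀ i, θ₂ i = p₁ₒ ∨ θ₂ i = p₁ᵤ ∨ θ₂ i = p₂ₒ ∨ θ₂ i = p₂ᵤ ∨ ∃ q, θ₂ i = θ q := by
  -- first chord: under-parameter, then over-parameter
  obtain ⟨u, hu⟩ := exists_strictMono_insertNth hθ h₂
  set θa : Fin (2 * G.n + 1) → ℝ := u.insertNth (α := fun _ ↦ ℝ) p₁ᵤ θ with hθa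
  have hθa_vals : ∀ i, θa i = p₁ᵤ ∨ ∃ q, θa i = θ q := insertNth_eq_or_exists u p₁ᵤ θ
  have hθa_ne : ∀ i, θa i ≠ p₁ₒ := by
    intro i
    rcases hθa_vals i with h | ⟨q, h⟩
    · rw [h]; exact h₁₂.symm
    · rw [h]; exact h₁ q
  obtain ⟨o, ho⟩ := exists_strictMono_insertNth hu hθa_ne
  set θ₁ : Fin (2 * G.n + 2) → ℝ := o.insertNth (α := fun _ ↦ ℝ) p₁ₒ θa with hθ₁
  have hθ₁_vals : ∀ i, θ₁ i = p₁ₒ ∨ θ₁ i = p₁ᵤ ∨ ∃ q, θ₁ i = θ q := by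
    intro i
    rcases insertNth_eq_or_exists o p₁ₒ θa i with h | ⟨r, h⟩
    · exact Or.inl h
    · rcases hθa_vals r with h' | ⟨q, h'⟩
      · exact Or.inr (Or.inl (h.trans h'))
      · exact Or.inr (Or.inr ⟨q, h.trans h'⟩)
  -- second chord: under-parameter, then over-parameter
  have hθ₁_ne₄ : ∀ i, θ₁ i ≠ p₂ᵤ := by
    intro i
    rcases hθ₁_vals i with h | h | ⟨q, h⟩
    · rw [h]; exact h₁₄
    · rw [h]; exact h₂₄
    · rw [h]; exact h₄ q
  obtain ⟨u', hu'⟩ := exists_strictMono_insertNth ho hθ₁_ne₄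
  set θb : Fin (2 * (G.n + 1) + 1) → ℝ := u'.insertNth (α := fun _ ↦ ℝ) p₂ᵤ θ₁ with hθb
  have hθb_vals : ∀ i, θb i = p₂ᵤ ∨ ∃ r, θb i = θ₁ r := insertNth_eq_or_exists u' p₂ᵤ θ₁
  have hθb_ne : ∀ i, θb i ≠ p₂ₒ := by
    intro i
    rcases hθb_vals i with h | ⟨r, h⟩
    · rw [h]; exact h₃₄.symm
    · rw [h]
      rcases hθ₁_vals r with h' | h' | ⟨q, h'⟩
      · rw [h']; exact h₁₃
      · rw [h']; exact h₂₃
      · rw [h']; exact h₃ q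
  obtain ⟨o', ho'⟩ := exists_strictMono_insertNth hu' hθb_ne
  set θ₂ : Fin (2 * (G.n + 1) + 2) → ℝ := o'.insertNth (α := fun _ ↦ ℝ) p₂ₒ θb with hθ₂
  refine ⟨o, u, o', u', θ₁, θ₂, ho, ho', ?_, ?_, fun q ↦ ?_, ?_, ?_, fun r ↦ ?_, fun i ↦ ?_⟩
  · simp [hθ₁]
  · simp [hθ₁, hθa]
  · simp [hθ₁, hθa]
  · simp [hθ₂]
  · simp [hθ₂, hθb]
  · simp [hθ₂, hθb]
  · rcases insertNth_eq_or_exists o' p₂ₒ θb i with h | ⟨j, h⟩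
    · exact Or.inr (Or.inr (Or.inl h))
    · rcases hθb_vals j with h' | ⟨r, h'⟩
      · exact Or.inr (Or.inr (Or.inr (Or.inl (h.trans h'))))
      · rcases hθ₁_vals r with h'' | h'' | ⟨q, h''⟩
        · exact Or.inl (h.trans (h'.trans h''))
        · exact Or.inr (Or.inl (h.trans (h'.trans h'')))
        · exact Or.inr (Or.inr (Or.inr (Or.inr ⟨q, h.trans (h'.trans h'')⟩)))

/-- **The period condition from the values**: if every entry of a tuple lies in a half-open
window of length `2π`, any two entries differ by less than `2π`. [folklore] -/
theorem lt_add_two_pi_of_mem_Ico {m : ℕ} {θ : Fin m → ℝ} {b : ℝ}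
    (h : ∀ i, θ i ∈ Ico b (b + 2 * Real.pi)) (i j : Fin m) : θ i < θ j + 2 * Real.pi := by
  linarith [(h i).2, (h j).1]

end GaussDiagram

end Literature.Topology.FourManifolds
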